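import Summits.BirchSwinnertonDyer.BirchSwinnertonDyer.Theorems.ManinLocalTwoThreeNotTrivialEisensteinModThree
import Literature.NumberTheory.EllipticCurves.SupersingularDensitySerreTraceProofs
import Literature.NumberTheory.EllipticCurves.CuspFormLFunctionLevelConductorProofs
import Literature.NumberTheory.EllipticCurves.NoConductorOne
import Literature.NumberTheory.GaloisRepresentations.IntegralGaloisActionProofs
import HarnessLib

/-!
# E-es-69♭ `NotTrivialEisensteinModThreeOfWitnessPrime` is a THEOREM: ONE good prime `ℓ ≡ 1 (mod 3)` with
# `a_ℓ(W) ≡ 1 (mod 3)` certifies hNT₃(3) — for EVERY `W`, reducible or not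

Summit `BirchSwinnertonDyer`, route `ManinLocalTwoThree` (cell bsd-f2-manin), crux C3 `ManinPrimeToThreeAtNine`
(stmt-BirchSwinnertonDyer-22968).  es's law **E-es-69♭** `KatoCurve.NotTrivialEisensteinModThreeOfWitnessPrime`
(`…ManinAdditive.NotTrivialEisensteinLocalisationThree`, es g19 MEMO-es §32; «THEOREM-candidate; Dirichlet for the quadratic kernel
character»; it is the census test E43 `pair`) says: for `W[3]` REDUCIBLE, one good prime `ℓ ∤ 3N`, `ℓ ≡ 1 (mod 3)` with
`a_ℓ(W) ≡ 1 (mod 3)` gives hNT₃(3) (`NotTrivialEisensteinModThreeAt W 3`: for all finite `S` and all `M` a prime `r ∉ S`,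
`r ≡ 1 (mod 3^M)`, with `a_r(W) ≢ r + 1 (mod 3)`).  It is PROVED here WITHOUT the reducibility hypothesis and without Dirichlet
characters, by the Chebotarev engine of the sibling file `ManinLocalTwoThreeNotTrivialEisensteinModThree` (E-es-40₃):

* §1 `mulVec_ne_of_trace_eq_one_of_det_eq_one` — over `𝔽₃` a `2 × 2` matrix with trace `1` and determinant `1` fixes no non-zero
  vector (`x² − x + 1` does not vanish at `1`; `decide` on residues).
* §2 `exists_prime_modEq_one_not_three_dvd_reductionPointCount_of_smul_ne` — the E-es-40₃ core with its only use of irreducibility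
  (the existence of a `τ ∈ Γ_ℚ` fixed-point-free on `W[3]`) turned into the hypothesis: from such a `τ`, for every finite `S` and `M`,
  a good prime `ℓ ∉ S`, `ℓ ≠ 3`, `ℓ ≡ 1 (mod 3^{M+1})`, `3 ∤ #W̃(𝔽_ℓ)` (framed `det ρ̄₃ = χ̄₃` dichotomy `k ∈ {3^M, 2·3^M}`, Chebotarev in
  `ℚ(W[3^{M+1}])`; the proof text is the sibling's, which remains the `W[3]`-irreducible special case).
* §3 `notTrivialEisensteinModThreeAt_of_witnessPrime` — a good prime `ℓ ≠ 3`, `ℓ ≡ 1 (mod 3)`, `a_ℓ(W) ≡ 1 (mod 3)` supplies the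
  `τ`: an arithmetic Frobenius `φ_ℓ` (`exists_isArithFrobAt_of_mem_primesAbove_holds`) has trace `a_ℓ ≡ 1` on `W[3]`
  (`trace_galoisRepTorsion_frobenius_eq`, Serre 1981 (238)) and determinant `χ̄₃(φ_ℓ) = 1` (`φ_ℓ ζ₃ = ζ₃^ℓ = ζ₃`), hence is
  fixed-point-free (§1).
* §4 **`notTrivialEisensteinModThreeOfWitnessPrime_holds : NotTrivialEisensteinModThreeOfWitnessPrime`** (any model: pass to a
  global minimal model, `LFunction_smul`; `ℓ ∤ N ⟹` good at `ℓ` by `IsNewformOf.dvd_level_iff_dvd_conductorNorm` and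
  `hasGoodReductionAtPrime_of_not_dvd_conductorNorm'`).

Axioms `propext`, `Classical.choice`, `Quot.sound`; no new definitions.  Nothing about BSD or Manin's conjecture is proved here
(E-es-69/69♮/69♯ and C3 stay OPEN).  References: J. Tate, GCFT (Cassels–Fröhlich 1967) §2.4; J.-P. Serre, Invent. Math. 15
(1972) §5.2; J.-P. Serre, Publ. Math. IHÉS 54 (1981) §8 (238); J. H. Silverman, *AEC* VII.3.1; HOME/MEMO-es.md §32 (E-es-69♭).
-/

set_option autoImplicit false
set_option linter.dupNamespace false

noncomputable section

open scoped Classical Matrix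

open NumberField IsDedekindDomain Field WeierstrassCurve
  Literature.NumberTheory.EllipticCurves Literature.NumberTheory.EllipticCurves.ModularForms
  Literature.NumberTheory.GaloisRepresentations
  Summit.BirchSwinnertonDyer.Rank1Residual.ManinAdditive
  Summit.BirchSwinnertonDyer.Rank1Residual.ManinAdditive.KatoCurve

namespace Summit.BirchSwinnertonDyer.BirchSwinnertonDyer.Theorems.ManinLocalTwoThree

/-! ### §1  Over `𝔽₃`: trace `1` and determinant `1` force fixed-point-freeness -/

/-- Residue core (`decide`): `a + d = 1`, `ad − bc = 1` ⟹ `(a b; c d)` fixes no non-zero vector of `𝔽₃²`. [folklore] -/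
theorem fixedPointFree_of_trace_eq_one_of_det_eq_one_zmod3 :
    ∀ a b c d : ZMod 3, a + d = 1 → a * d - b * c = 1 →
      ∀ x y : ZMod 3, a * x + b * y = x → c * x + d * y = y → x = 0 ∧ y = 0 := by
  decide

/-- **A `2 × 2` matrix over `𝔽₃` with trace `1` and determinant `1` fixes no non-zero vector** (its characteristic polynomial
`x² − x + 1` has `1 − 1 + 1 ≠ 0`). [folklore] -/
theorem mulVec_ne_of_trace_eq_one_of_det_eq_one (A : Matrix (Fin 2) (Fin 2) (ZMod 3)) (htr : A.trace = 1)
    (hdet : A.det = 1) : ∀ v : Fin 2 → ZMod 3, v ≠ 0 → A.mulVec v ≠ v := by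
  intro v hv h
  rw [Matrix.trace_fin_two] at htr
  rw [Matrix.det_fin_two] at hdet
  rw [mulVec_fin_two] at h
  have h0 := congrFun h 0
  have h1 := congrFun h 1
  simp only [Matrix.cons_val_zero, Matrix.cons_val_one] at h0 h1
  have key := fixedPointFree_of_trace_eq_one_of_det_eq_one_zmod3 (A 0 0) (A 0 1) (A 1 0) (A 1 1) htr hdet (v 0) (v 1) h0 h1
  apply hv
  ext i; fin_cases i
  · exact key.1
  · exact key.2

/-! ### §2  The Chebotarev engine from a fixed-point-free element -/

section Core

/-- The units of `𝔽₃` are `±1`. [folklore] -/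
private theorem units_zmod_three' (u : (ZMod 3)ˣ) : u = 1 ∨ u = -1 := by
  fin_cases u <;> decide

/-- **Primes `ℓ ≡ 1 (mod 3^{M+1})` of good reduction, off any finite set, with `3 ∤ #W̃(𝔽_ℓ)`, from ONE `τ ∈ Γ_ℚ` fixed-point-free
on `W[3]`** (`W` globally minimal).  The argument of `exists_prime_modEq_one_not_three_dvd_reductionPointCount` (sibling file,
E-es-40₃) verbatim after its step (1): framed determinant dichotomy `det ρ̄₃(τ) = ±1` choosing `k ∈ {3^M, 2·3^M}` with `τ^k`
fixed-point-free on `W[3]` and fixing a primitive `3^{M+1}`-th root of unity in `ℚ(W[3^{M+1}])`, then Chebotarev and reduction of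
torsion. [cite: TateGCFT1967, §2.4 (Tchebotarev density theorem)] [cite: Serre1972, §5.2 (iii)–(iv)] -/
theorem exists_prime_modEq_one_not_three_dvd_reductionPointCount_of_smul_ne (W : WeierstrassCurve ℚ) [W.IsElliptic]
    [W.IsGloballyMinimal] (τ : absoluteGaloisGroup ℚ) (hτ : ∀ P : W.geomTorsion ((3 : ℕ) : ℤ), P ≠ 0 → τ • P ≠ P)
    (S : Finset ℕ) (M : ℕ) :
    ∃ (r : ℕ) (_ : Fact r.Prime), r ∉ S ∧ r ≠ 3 ∧ r ≡ 1 [MOD 3 ^ (M + 1)] ∧ W.HasGoodReductionAtPrime r ∧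
      ¬ 3 ∣ W.reductionPointCount r := by
  classical
  haveI : Fact (Nat.Prime 3) := ⟨Nat.prime_three⟩
  haveI : NeZero (3 ^ (M + 1)) := ⟨pow_ne_zero _ three_ne_zero⟩
  haveI : NeZero ((3 : ℕ) : ℚ) := ⟨by norm_num⟩
  have hq2 : 2 ≤ 3 ^ (M + 1) := by
    calc (2 : ℕ) ≤ 3 ^ 1 := by norm_num
      _ ≤ 3 ^ (M + 1) := Nat.pow_le_pow_right (by norm_num) (by omega)
  have hqpos : 0 < 3 ^ (M + 1) := by positivity
  have h3 : ∀ P : W.geomTorsion ((3 : ℕ) : ℤ), P + P + P = 0 := by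
    intro P
    have hP : ((3 : ℕ) : ℤ) • (P : W.geomPoints) = 0 := by
      simpa only [AddSubgroup.torsionBy, Submodule.mem_toAddSubgroup, Submodule.mem_torsionBy_iff] using P.2
    apply Subtype.ext
    show (P : W.geomPoints) + P + P = 0
    have e3 : (P : W.geomPoints) + P + P = (3 : ℤ) • (P : W.geomPoints) := by
      rw [show (3 : ℤ) = 1 + 1 + 1 by norm_num, add_zsmul, add_zsmul, one_zsmul]
    rw [e3]
    exact_mod_cast hP
  -- (2) the frame `W[3] ≅ 𝔽₃²` and the matrix of `τ`
  obtain ⟨e, Φ, hframe, -, hdet, -, -⟩ := exists_frame_galoisRepTorsion_rat W 3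
  set A : Matrix (Fin 2) (Fin 2) (ZMod 3) := ((Φ (galoisRepTorsion W ((3 : ℕ) : ℤ) τ) : GL (Fin 2) (ZMod 3)) :
    Matrix (Fin 2) (Fin 2) (ZMod 3)) with hAdef
  have hAe : ∀ P : W.geomTorsion ((3 : ℕ) : ℤ), e (τ • P) = A.mulVec (e P) := fun P ↦ by
    have h := hframe (galoisRepTorsion W ((3 : ℕ) : ℤ) τ) P
    rwa [galoisRepTorsion_apply] at h
  have hA : ∀ v : Fin 2 → ZMod 3, v ≠ 0 → A.mulVec v ≠ v := by
    intro v hv h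
    have hP : e.symm v ≠ 0 := fun h0 ↦ hv (by simpa using congrArg e h0)
    refine hτ (e.symm v) hP (e.injective ?_)
    rw [hAe, e.apply_symm_apply, h]
  have hdetτ : A.det = ((modPCyclotomicCharacterZMod ℚ 3 τ : (ZMod 3)ˣ) : ZMod 3) := by
    rw [hAdef, ← Matrix.GeneralLinearGroup.val_det_apply, hdet]
  -- (3) a primitive `3^{M+1}`-th root of unity fixed by the pointwise stabiliser of `W[3^{M+1}]`, and `τ ζ = ζ^a`
  obtain ⟨ζ, hζ, hζfix⟩ := exists_isPrimitiveRoot_fixed (E := W) (q := 3 ^ (M + 1)) hq2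
    (exists_geomTorsion_exactOrder_prime W Nat.prime_three M)
  have hτζq : (τ • ζ) ^ 3 ^ (M + 1) = 1 := by rw [← smul_pow', hζ.pow_eq_one, smul_one]
  obtain ⟨a, -, ha⟩ := hζ.eq_pow_of_pow_eq_one hτζq
  have hprim : IsPrimitiveRoot (τ • ζ) (3 ^ (M + 1)) :=
    hζ.map_of_injective (f := (show AlgebraicClosure ℚ ≃ₐ[ℚ] AlgebraicClosure ℚ from τ))
      (show AlgebraicClosure ℚ ≃ₐ[ℚ] AlgebraicClosure ℚ from τ).injective
  rw [← ha] at hprim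
  have hacop : a.Coprime (3 ^ (M + 1)) := (hζ.pow_iff_coprime hqpos a).mp hprim
  have ha0 : 0 < a := by
    rcases Nat.eq_zero_or_pos a with h0 | h0
    · rw [h0, Nat.coprime_zero_left] at hacop
      omega
    · exact h0
  have hpow : ∀ j : ℕ, (τ ^ j) • ζ = ζ ^ (a ^ j) := by
    intro j
    induction j with
    | zero => rw [pow_zero, one_smul, pow_zero, pow_one]
    | succ j ih => rw [pow_succ, mul_smul, ← ha, smul_pow', ih, ← pow_mul, ← pow_succ]
  have hne : ζ ≠ 0 := hζ.ne_zero hqpos.ne'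
  have hfixpow : ∀ c : ℕ, 1 ≤ c → c ≡ 1 [MOD 3 ^ (M + 1)] → ζ ^ c = ζ := by
    intro c hc hmod
    obtain ⟨d, hd⟩ := (Nat.modEq_iff_dvd' hc).mp hmod.symm
    have ec : c = 3 ^ (M + 1) * d + 1 := by omega
    rw [ec, pow_succ, pow_mul, hζ.pow_eq_one, one_pow, one_mul]
  -- (4) the exponent `k`
  have key : ∃ k : ℕ, (∀ P : W.geomTorsion ((3 : ℕ) : ℤ), P ≠ 0 → (τ ^ k) • P ≠ P) ∧ (τ ^ k) • ζ = ζ := by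
    rcases units_zmod_three' (modPCyclotomicCharacterZMod ℚ 3 τ) with h1 | hm1
    · refine ⟨3 ^ M, pow_three_pow_smul_ne_self h3 hτ M, ?_⟩
      have hζ3 : (ζ ^ 3 ^ M) ^ 3 = 1 := by rw [← pow_mul, ← pow_succ, hζ.pow_eq_one]
      have hτζ3 : τ • (ζ ^ 3 ^ M) = ζ ^ 3 ^ M := by
        rw [modPCyclotomicCharacterZMod_spec ℚ 3 τ _ hζ3, h1, Units.val_one, ZMod.val_one, pow_one]
      rw [smul_pow', ← ha, ← pow_mul] at hτζ3
      have h31 : ζ ^ (3 ^ M * (a - 1)) = 1 := by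
        have e1 : a * 3 ^ M = 3 ^ M * (a - 1) + 3 ^ M := by
          zify [ha0]
          ring
        rw [e1, pow_add] at hτζ3
        exact (mul_eq_right₀ (pow_ne_zero _ hne)).mp hτζ3
      have hdvd := (hζ.pow_eq_one_iff_dvd _).mp h31
      rw [pow_succ] at hdvd
      have h3a : 3 ∣ a - 1 := Nat.dvd_of_mul_dvd_mul_left (by positivity) hdvd
      have ha1 : a ≡ 1 [MOD 3] := ((Nat.modEq_iff_dvd' ha0).mpr h3a).symm
      rw [hpow]
      exact hfixpow _ (Nat.one_le_pow _ _ ha0) (pow_prime_pow_modEq_one ha1 M)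
    · have hdet' : A.det = -1 := by rw [hdetτ, hm1, Units.val_neg, Units.val_one]
      have hA2 := sq_mulVec_ne_of_det_eq_neg_one A hdet' hA
      have hAe2 : ∀ P : W.geomTorsion ((3 : ℕ) : ℤ), e ((τ ^ 2) • P) = (A * A).mulVec (e P) := fun P ↦ by
        have h := hframe (galoisRepTorsion W ((3 : ℕ) : ℤ) (τ ^ 2)) P
        rwa [galoisRepTorsion_apply, map_pow, map_pow, Units.val_pow_eq_pow_val, ← hAdef, pow_two A] at h
      have hτ2 : ∀ P : W.geomTorsion ((3 : ℕ) : ℤ), P ≠ 0 → (τ ^ 2) • P ≠ P := by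
        intro P hP h
        have hv : e P ≠ 0 := fun h0 ↦ hP (e.injective (by simpa using h0))
        exact hA2 (e P) hv (by rw [← hAe2, h])
      refine ⟨3 ^ M * 2, ?_, ?_⟩
      · intro P hP
        rw [mul_comm, pow_mul]
        exact pow_three_pow_smul_ne_self h3 hτ2 M P hP
      · rw [hpow]
        refine hfixpow _ (Nat.one_le_pow _ _ ha0) ?_
        have h1 : a ^ Nat.totient (3 ^ (M + 1)) ≡ 1 [MOD 3 ^ (M + 1)] := Nat.ModEq.pow_totient hacop
        have htot : Nat.totient (3 ^ (M + 1)) = 3 ^ M * 2 := by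
          rw [Nat.totient_prime_pow Nat.prime_three (by omega : 0 < M + 1), Nat.add_sub_cancel]
        rwa [htot] at h1
  obtain ⟨k, hσ, hσζ⟩ := key
  -- (5) Chebotarev off `S ∪ {3} ∪ {bad primes}`
  have hΔ0 : minimalDiscriminantInt W ≠ 0 := minimalDiscriminantInt_ne_zero W
  let S' : Set ℕ := {ℓ | ℓ = 3 ∨ (ℓ : ℤ) ∣ minimalDiscriminantInt W ∨ ℓ ∈ S}
  have hS' : S'.Finite := by
    refine ((Set.finite_le_nat (max 3 (minimalDiscriminantInt W).natAbs)).union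
      (S : Set ℕ).toFinite).subset ?_
    rintro ℓ (rfl | hℓ | hℓ)
    · exact Or.inl (Set.mem_setOf.mpr (le_max_left _ _))
    · exact Or.inl (Set.mem_setOf.mpr (le_max_of_le_right
        (Nat.le_of_dvd (Int.natAbs_pos.mpr hΔ0) (Int.natCast_dvd.mp hℓ))))
    · exact Or.inr hℓ
  obtain ⟨ℓ, v, 𝔓, φ, hℓ, hℓS, hv, h𝔓, hφ, hagree⟩ :=
    chebotarev_geomTorsion_holds W ((3 ^ (M + 1) : ℕ) : ℤ) (by exact_mod_cast hqpos.ne') S' hS' (τ ^ k)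
  haveI : Fact ℓ.Prime := ⟨hℓ⟩
  have hℓ3 : ℓ ≠ 3 := fun h ↦ hℓS (Or.inl h)
  have hℓΔ : ¬ (ℓ : ℤ) ∣ minimalDiscriminantInt W := fun h ↦ hℓS (Or.inr (Or.inl h))
  have hℓS₀ : ℓ ∉ S := fun h ↦ hℓS (Or.inr (Or.inr h))
  have hgood : W.HasGoodReductionAtPrime ℓ := hasGoodReductionAtPrime_of_not_dvd W ℓ hℓΔ
  -- (6) the Frobenius fixes `ζ`
  have hψ : ∀ T : W.geomTorsion ((3 ^ (M + 1) : ℕ) : ℤ), ((τ ^ k)⁻¹ * φ) • T = T := by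
    intro T
    rw [mul_smul, hagree T, inv_smul_smul]
  have hφζ : φ • ζ = ζ := by
    have h1 := hζfix _ hψ
    rw [mul_smul] at h1
    have h2' := congrArg (fun x ↦ (τ ^ k) • x) h1
    simp only [smul_inv_smul] at h2'
    rw [h2', hσζ]
  -- (7) `ℓ ≡ 1 (mod 3^{M+1})`
  have hfrob := frob_smul_eq_pow_of_pow_eq_one_prime (k := M + 1) hℓ Nat.prime_three hℓ3 hv h𝔓 hφ hζ.pow_eq_one
  have hℓ1 : ℓ ≡ 1 [MOD 3 ^ (M + 1)] := by
    have hz : ζ ^ ℓ = ζ := by rw [← hfrob, hφζ]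
    have h1 : ζ ^ (ℓ - 1) = 1 := by
      have : ζ ^ (ℓ - 1) * ζ = 1 * ζ := by
        rw [← pow_succ, Nat.sub_add_cancel hℓ.one_le, one_mul, hz]
      exact mul_right_cancel₀ hne this
    have hdvd := (hζ.pow_eq_one_iff_dvd (ℓ - 1)).mp h1
    exact ((Nat.modEq_iff_dvd' hℓ.one_le).mpr hdvd).symm
  -- (8) `3 ∤ #W̃(𝔽_ℓ)`
  refine ⟨ℓ, ⟨hℓ⟩, hℓS₀, hℓ3, hℓ1, hgood, fun hdvd3 ↦ ?_⟩
  obtain ⟨P, hP0, hP⟩ :=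
    exists_frobenius_smul_eq_of_dvd_reductionPointCount_holds W 3 ℓ hℓ3 hgood hdvd3 v hv 𝔓 h𝔓 φ hφ
  have hP3 : ((3 : ℕ) : ℤ) • (P : W.geomPoints) = 0 := by
    simpa only [AddSubgroup.torsionBy, Submodule.mem_toAddSubgroup, Submodule.mem_torsionBy_iff] using P.2
  have hPq : (P : W.geomPoints) ∈ W.geomTorsion ((3 ^ (M + 1) : ℕ) : ℤ) := by
    simp only [Submodule.mem_toAddSubgroup, Submodule.mem_torsionBy_iff]
    rw [Nat.cast_pow, pow_succ, mul_smul]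
    show ((3 : ℕ) : ℤ) ^ M • (((3 : ℕ) : ℤ) • (P : W.geomPoints)) = 0
    rw [hP3, smul_zero]
  have hval : φ • (P : W.geomPoints) = (τ ^ k) • (P : W.geomPoints) :=
    congrArg Subtype.val (hagree ⟨P, hPq⟩)
  apply hσ P hP0
  apply Subtype.ext
  rw [AddSubgroup.torsionBy.coe_smul, ← hval, ← AddSubgroup.torsionBy.coe_smul, hP]

end Core

/-! ### §3  A witness prime supplies the fixed-point-free element -/

/-- The rational prime below a finite place `v` of `ℚ` lies in `v` (private copy of the tree's
`natCast_natGenerator_mem_asIdeal`). [folklore] -/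
private theorem natCast_primesEquiv_mem_asIdeal' (v : HeightOneSpectrum (𝓞 ℚ)) :
    (((Rat.HeightOneSpectrum.primesEquiv v : Nat.Primes) : ℕ) : 𝓞 ℚ) ∈ v.asIdeal := by
  have h := (Rat.HeightOneSpectrum.natGenerator_dvd_iff v).mp dvd_rfl
  rwa [← map_natCast (Rat.IsIntegralClosure.intEquiv (𝓞 ℚ)), Ideal.apply_mem_of_equiv_iff] at h

/-- **hNT₃(3) from ONE witness prime** (globally minimal model): if `ℓ ≠ 3` is a prime of good reduction with `ℓ ≡ 1 (mod 3)` and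
`a_ℓ(W) ≡ 1 (mod 3)`, then for every finite `S` and every `M` some prime `r ∉ S`, `r ≡ 1 (mod 3^M)`, has `a_r(W) ≢ r + 1 (mod 3)`.
An arithmetic Frobenius `φ_ℓ` above `ℓ` has trace `a_ℓ ≡ 1` on `W[3]` (Serre 1981 (238), tree `trace_galoisRepTorsion_frobenius_eq`)
and determinant `χ̄₃(φ_ℓ) = 1` (`φ_ℓ ζ₃ = ζ₃^ℓ = ζ₃`), so it is fixed-point-free on `W[3]` (§1) and §2 applies. No reducibility or
irreducibility hypothesis. [cite: Serre1981, §8.1 eq. (238) (p. 188)] [cite: TateGCFT1967, §2.4 (Tchebotarev density theorem)] -/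
theorem notTrivialEisensteinModThreeAt_of_witnessPrime (W : WeierstrassCurve ℚ) [W.IsElliptic] [W.IsGloballyMinimal]
    {ℓ : ℕ} [Fact ℓ.Prime] (hℓ3 : ℓ ≠ 3) (hgood : W.HasGoodReductionAtPrime ℓ) (hℓ1 : ℓ % 3 = 1)
    (ha : ((W.LFunction ℓ : ℤ) : ZMod 3) = 1) : NotTrivialEisensteinModThreeAt W 3 := by
  classical
  have hℓ : ℓ.Prime := Fact.out
  haveI : Fact (Nat.Prime 3) := ⟨Nat.prime_three⟩
  haveI : NeZero ((3 : ℕ) : ℚ) := ⟨by norm_num⟩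
  -- the place, a prime of `\bar ℤ` above it, an arithmetic Frobenius
  set v : HeightOneSpectrum (𝓞 ℚ) := (Rat.HeightOneSpectrum.primesEquiv (R := 𝓞 ℚ)).symm ⟨ℓ, hℓ⟩ with hvdef
  have hvℓ : ((Rat.HeightOneSpectrum.primesEquiv v : Nat.Primes) : ℕ) = ℓ := by
    rw [hvdef, Equiv.apply_symm_apply]
  have hv : (ℓ : 𝓞 ℚ) ∈ v.asIdeal := by
    have h := natCast_primesEquiv_mem_asIdeal' v
    rwa [hvℓ] at h
  obtain ⟨𝔓, h𝔓⟩ := HeightOneSpectrum.primesAbove_nonempty v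
  obtain ⟨φ, hφ⟩ := HeightOneSpectrum.exists_isArithFrobAt_of_mem_primesAbove_holds h𝔓
  -- the frame and the matrix of `φ`
  obtain ⟨e, Φ, hframe, htrace, hdet, -, -⟩ := exists_frame_galoisRepTorsion_rat W 3
  set A : Matrix (Fin 2) (Fin 2) (ZMod 3) := ((Φ (galoisRepTorsion W ((3 : ℕ) : ℤ) φ) : GL (Fin 2) (ZMod 3)) :
    Matrix (Fin 2) (Fin 2) (ZMod 3)) with hAdef
  -- trace `= a_ℓ mod 3 = 1`
  have htrA : A.trace = 1 := by
    rw [hAdef, htrace, W.trace_galoisRepTorsion_frobenius_eq 3 hℓ3 hgood hvℓ h𝔓 hφ,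
      ← W.LFunction_apply_prime_eq_frobeniusTrace ℓ hgood, ha]
  -- determinant `= χ̄₃(φ) = 1` since `φ ζ₃ = ζ₃^ℓ = ζ₃`
  obtain ⟨ζ₃, hζ₃⟩ := HasEnoughRootsOfUnity.prim (M := AlgebraicClosure ℚ) (n := 3)
  have hζ₃pow : ζ₃ ^ 3 ^ 1 = 1 := by rw [pow_one]; exact hζ₃.pow_eq_one
  have hφζ : φ • ζ₃ = ζ₃ := by
    rw [frob_smul_eq_pow_of_pow_eq_one_prime (k := 1) hℓ Nat.prime_three hℓ3 hv h𝔓 hφ hζ₃pow]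
    obtain ⟨c, hc⟩ : ∃ c, ℓ = 3 * c + 1 := ⟨ℓ / 3, by omega⟩
    rw [hc, pow_succ, pow_mul, hζ₃.pow_eq_one, one_pow, one_mul]
  have hχ : modPCyclotomicCharacterZMod ℚ 3 φ = 1 := by
    rcases units_zmod_three' (modPCyclotomicCharacterZMod ℚ 3 φ) with h1 | hm1
    · exact h1
    · exfalso
      have hspec := modPCyclotomicCharacterZMod_spec ℚ 3 φ ζ₃ hζ₃.pow_eq_one
      have hval : (-1 : ZMod 3).val = 2 := rfl
      rw [hφζ, hm1, Units.val_neg, Units.val_one, hval] at hspec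
      -- `ζ₃ = ζ₃²` forces `ζ₃ = 1`
      have hne : ζ₃ ≠ 0 := hζ₃.ne_zero (by norm_num)
      have h1 : ζ₃ = 1 := by
        have : ζ₃ * ζ₃ = ζ₃ * 1 := by rw [mul_one, ← pow_two]; exact hspec.symm
        exact mul_left_cancel₀ hne this
      exact hζ₃.ne_one (by norm_num) h1
  have hdetA : A.det = 1 := by
    rw [hAdef, ← Matrix.GeneralLinearGroup.val_det_apply, hdet, hχ, Units.val_one]
  -- `φ` is fixed-point-free on `W[3]`
  have hA := mulVec_ne_of_trace_eq_one_of_det_eq_one A htrA hdetA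
  have hφfree : ∀ P : W.geomTorsion ((3 : ℕ) : ℤ), P ≠ 0 → φ • P ≠ P := by
    intro P hP h
    have hvne : e P ≠ 0 := fun h0 ↦ hP (e.injective (by simpa using h0))
    refine hA (e P) hvne ?_
    have h' := hframe (galoisRepTorsion W ((3 : ℕ) : ℤ) φ) P
    rw [galoisRepTorsion_apply, h] at h'
    exact h'.symm
  -- conclude
  intro S M
  obtain ⟨r, hr, hrS, _, hmod, hgoodr, hndvd⟩ :=
    exists_prime_modEq_one_not_three_dvd_reductionPointCount_of_smul_ne W φ hφfree S M
  refine ⟨r, hr.out, hrS, ?_, ?_⟩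
  · rw [pow_succ'] at hmod
    exact Nat.ModEq.of_mul_left 3 hmod
  · rw [WeierstrassCurve.LFunction_apply_prime_eq_frobeniusTrace W r hgoodr]
    intro heq
    apply hndvd
    have h3 : ((((r : ℤ) + 1 : ℤ)) : ZMod 3) = ((W.frobeniusTrace r : ℤ) : ZMod 3) := by
      rw [heq]; push_cast; ring
    have h3' := (ZMod.intCast_eq_intCast_iff_dvd_sub ((r : ℤ) + 1) (W.frobeniusTrace r) 3).mp h3
    exact (dvd_frobeniusTrace_sub_iff W 3 r).mp (by exact_mod_cast h3')

/-! ### §4  E-es-69♭ -/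

/-- **E-es-69♭ `NotTrivialEisensteinModThreeOfWitnessPrime` (es g19, MEMO-es §32; the `@[conjecture]` row of
`NotTrivialEisensteinLocalisationThree`) is a THEOREM** — indeed WITHOUT its hypothesis `¬ W.HasIrreducibleModPGaloisRep 3`: for
an elliptic `W/ℚ` with newform `f` of level `N` and one prime `ℓ ∤ 3N`, `ℓ ≡ 1 (mod 3)`, `a_ℓ(W) ≡ 1 (mod 3)`, hNT₃(3) holds.
(Global minimal model `C • W`: `LFunction_smul`; `ℓ ∤ N ⟹ ℓ` good by `IsNewformOf.dvd_level_iff_dvd_conductorNorm` — Diamond–Shurman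
(8.44), no Carayol — and `hasGoodReductionAtPrime_of_not_dvd_conductorNorm'`; then §3.) [cite: TateGCFT1967, §2.4 (Tchebotarev density theorem)]
[cite: DiamondShurman2005, Prop. 5.8.5 and (8.44)] -/
theorem notTrivialEisensteinModThreeOfWitnessPrime_holds : NotTrivialEisensteinModThreeOfWitnessPrime := by
  intro W _ N _ f hf _ hwit
  classical
  obtain ⟨ℓ, hℓ, hℓN, hℓ1, ha⟩ := hwit
  haveI : Fact ℓ.Prime := ⟨hℓ⟩
  obtain ⟨C, hC⟩ := WeierstrassCurve.hasGlobalMinimalModel_rat_holds W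
  haveI := hC
  have hf' : IsNewformOf (C • W) f := ⟨hf.1, fun n ↦ by rw [hf.2 n, WeierstrassCurve.LFunction_smul]⟩
  have hℓ3 : ℓ ≠ 3 := by
    rintro rfl
    exact hℓN (dvd_mul_right 3 N)
  have hℓN' : ¬ ℓ ∣ N := fun h ↦ hℓN (dvd_mul_of_dvd_right h 3)
  have hgood : (C • W).HasGoodReductionAtPrime ℓ :=
    hasGoodReductionAtPrime_of_not_dvd_conductorNorm' (C • W)
      (fun h ↦ hℓN' ((hf'.dvd_level_iff_dvd_conductorNorm hℓ).mpr h))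
  have ha' : ((((C • W).LFunction ℓ : ℤ)) : ZMod 3) = 1 := by rw [WeierstrassCurve.LFunction_smul]; exact ha
  have key := notTrivialEisensteinModThreeAt_of_witnessPrime (C • W) hℓ3 hgood hℓ1 ha'
  intro S M
  obtain ⟨r, hr, hrS, hmod, hne⟩ := key S M
  refine ⟨r, hr, hrS, hmod, ?_⟩
  rwa [WeierstrassCurve.LFunction_smul] at hne

end Summit.BirchSwinnertonDyer.BirchSwinnertonDyer.Theorems.ManinLocalTwoThree

end
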